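import Summits.MatrixMultiplication.MatrixMultiplication.Theorems.AbelianSTPPCensusTAStatSound
import Summits.MatrixMultiplication.MatrixMultiplication.Theorems.AbelianSTPPCensusTAStatDom1
import Summits.MatrixMultiplication.MatrixMultiplication.Theorems.AbelianSTPPCensusTAStatDom2
import Summits.MatrixMultiplication.MatrixMultiplication.Theorems.AbelianSTPPCensusTAStatDom3
import Summits.MatrixMultiplication.MatrixMultiplication.Theorems.AbelianSTPPCensusTAStatDom4
import Summits.MatrixMultiplication.MatrixMultiplication.Theorems.AbelianSTPPCensusTAStatCk01
import Summits.MatrixMultiplication.MatrixMultiplication.Theorems.AbelianSTPPCensusTAStatCk02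
import Summits.MatrixMultiplication.MatrixMultiplication.Theorems.AbelianSTPPCensusTAStatCk03
import Summits.MatrixMultiplication.MatrixMultiplication.Theorems.AbelianSTPPCensusTAStatCk04
import Summits.MatrixMultiplication.MatrixMultiplication.Theorems.AbelianSTPPCensusTAStatCk05
import Summits.MatrixMultiplication.MatrixMultiplication.Theorems.AbelianSTPPCensusTAStatCk06
import Summits.MatrixMultiplication.MatrixMultiplication.Theorems.AbelianSTPPCensusTAStatCk07
import Summits.MatrixMultiplication.MatrixMultiplication.Theorems.AbelianSTPPCensusTAStatCk08
import Summits.MatrixMultiplication.MatrixMultiplication.Theorems.AbelianSTPPCensusLeafTA1700Closed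
import Summits.MatrixMultiplication.MatrixMultiplication.Theorems.AbelianSTPPCensusVPGrynkiewiczWeak

/-!
# T_A/5000: no abelian STPP host of order `≤ 5000` beats `τ = 2.371` (the static t*-indexed linear certificate)

Cell mm-stpp (rung F-M1, D-0059/D-0061), T_A = the brief's threshold «beat the record exponent `2.371`»: for every finite abelian group `H` with
`|H| ≤ 5000` and every STPP family `(A_i,B_i,C_i)` in `H`, `Σ_i (|A_i||B_i||C_i|)^{2.371/3} ≤ |H|`.  Stated on `NoAbelianSTPPHostUpTo (2371/1000) 5000`.
Assembly: `|H| ≤ 1700` by `noAbelianSTPPHostUpTo_2371_1700` (p523821); `1701 … 5000` by vM soundness `AbelianTECensus.sieveSound`, U11-G soundness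
`u11GSound_holds` ([Gry10] kernel port), E3 soundness `TAKnap575.e3Adm_of_isSTPP` (three-room energy) and the static t*-indexed certificate
`TAStat.not_beats_of_cert` (`AbelianSTPPCensusTAStatSound.lean`) fed with the kernel evaluations `TAStat.mono_ok`, `TAStat.dom*`
(`…TAStatDom1–4`) and `TAStat.ck*` (`…TAStatCk01–08`); degenerate / one-member families by `AbelianTECensus.noAbelianSTPPHostUpTo_of_two`.
The design change against T_A/1700 (budget indexed by `t* = max_i t_i`, orders covered by affine endpoint checks, static density table) is
described in `AbelianSTPPCensusTAStatDefs.lean`; the same linear relaxation first fails at order `5675`, and the rule set vM ∪ U11-G ∪ E3 is itself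
blind from `7045` (`TALinWall.vmU11GE3CensusTA_false_at_7045`).
WHAT THIS IS NOT: no bound on `ω` (rung-leaf class, never summit credit); nothing about orders `≥ 5001`; nothing about `T_E`/`T_D` or non-abelian
hosts; no existence claim.
-/

set_option linter.dupNamespace false
set_option autoImplicit false

namespace Summit.MatrixMultiplication.MatrixMultiplication.Theorems

namespace TAStat

open ShapeCert (gainOf2371h)

/-- every sorted candidate shape of every volume `1 … 5000` is dominated by the table (the `dom*` kernel chunks, tiled) -/
theorem dom_all : ∀ V, 1 ≤ V → V ≤ 5000 → ∀ x ∈ triplesS V, domX V (gainOf2371h V) x = true := by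
  intro V h1 h2
  by_cases c1 : V ≤ 528
  · exact domV_sound _ _ dom1 V (by omega) (by omega)
  by_cases c529 : V ≤ 928
  · exact domV_sound _ _ dom529 V (by omega) (by omega)
  by_cases c929 : V ≤ 1296
  · exact domV_sound _ _ dom929 V (by omega) (by omega)
  by_cases c1297 : V ≤ 1642
  · exact domV_sound _ _ dom1297 V (by omega) (by omega)
  by_cases c1643 : V ≤ 1975
  · exact domV_sound _ _ dom1643 V (by omega) (by omega)
  by_cases c1976 : V ≤ 2295
  · exact domV_sound _ _ dom1976 V (by omega) (by omega)
  by_cases c2296 : V ≤ 2620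
  · exact domV_sound _ _ dom2296 V (by omega) (by omega)
  by_cases c2621 : V ≤ 2964
  · exact domV_sound _ _ dom2621 V (by omega) (by omega)
  by_cases c2965 : V ≤ 3300
  · exact domV_sound _ _ dom2965 V (by omega) (by omega)
  by_cases c3301 : V ≤ 3650
  · exact domV_sound _ _ dom3301 V (by omega) (by omega)
  by_cases c3651 : V ≤ 4004
  · exact domV_sound _ _ dom3651 V (by omega) (by omega)
  by_cases c4005 : V ≤ 4400
  · exact domV_sound _ _ dom4005 V (by omega) (by omega)
  exact domV_sound _ _ dom4401 V (by omega) (by omega)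

/-- every sorted candidate shape of every volume `1 … 5000` passes `checkShape` (the `ck*` kernel chunks, tiled) -/
theorem ck_all : ∀ V, 1 ≤ V → V ≤ 5000 → ∀ x ∈ triplesS V, checkShape V (gainOf2371h V) x = true := by
  intro V h1 h2
  by_cases c1 : V ≤ 380
  · exact checkV_sound _ _ ck1 V (by omega) (by omega)
  by_cases c381 : V ≤ 590
  · exact checkV_sound _ _ ck381 V (by omega) (by omega)
  by_cases c591 : V ≤ 776
  · exact checkV_sound _ _ ck591 V (by omega) (by omega)
  by_cases c777 : V ≤ 946
  · exact checkV_sound _ _ ck777 V (by omega) (by omega)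
  by_cases c947 : V ≤ 1107
  · exact checkV_sound _ _ ck947 V (by omega) (by omega)
  by_cases c1108 : V ≤ 1260
  · exact checkV_sound _ _ ck1108 V (by omega) (by omega)
  by_cases c1261 : V ≤ 1410
  · exact checkV_sound _ _ ck1261 V (by omega) (by omega)
  by_cases c1411 : V ≤ 1554
  · exact checkV_sound _ _ ck1411 V (by omega) (by omega)
  by_cases c1555 : V ≤ 1692
  · exact checkV_sound _ _ ck1555 V (by omega) (by omega)
  by_cases c1693 : V ≤ 1827
  · exact checkV_sound _ _ ck1693 V (by omega) (by omega)
  by_cases c1828 : V ≤ 1960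
  · exact checkV_sound _ _ ck1828 V (by omega) (by omega)
  by_cases c1961 : V ≤ 2090
  · exact checkV_sound _ _ ck1961 V (by omega) (by omega)
  by_cases c2091 : V ≤ 2218
  · exact checkV_sound _ _ ck2091 V (by omega) (by omega)
  by_cases c2219 : V ≤ 2340
  · exact checkV_sound _ _ ck2219 V (by omega) (by omega)
  by_cases c2341 : V ≤ 2464
  · exact checkV_sound _ _ ck2341 V (by omega) (by omega)
  by_cases c2465 : V ≤ 2604
  · exact checkV_sound _ _ ck2465 V (by omega) (by omega)
  by_cases c2605 : V ≤ 2751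
  · exact checkV_sound _ _ ck2605 V (by omega) (by omega)
  by_cases c2752 : V ≤ 2890
  · exact checkV_sound _ _ ck2752 V (by omega) (by omega)
  by_cases c2891 : V ≤ 3030
  · exact checkV_sound _ _ ck2891 V (by omega) (by omega)
  by_cases c3031 : V ≤ 3168
  · exact checkV_sound _ _ ck3031 V (by omega) (by omega)
  by_cases c3169 : V ≤ 3306
  · exact checkV_sound _ _ ck3169 V (by omega) (by omega)
  by_cases c3307 : V ≤ 3450
  · exact checkV_sound _ _ ck3307 V (by omega) (by omega)
  by_cases c3451 : V ≤ 3600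
  · exact checkV_sound _ _ ck3451 V (by omega) (by omega)
  by_cases c3601 : V ≤ 3744
  · exact checkV_sound _ _ ck3601 V (by omega) (by omega)
  by_cases c3745 : V ≤ 3900
  · exact checkV_sound _ _ ck3745 V (by omega) (by omega)
  by_cases c3901 : V ≤ 4056
  · exact checkV_sound _ _ ck3901 V (by omega) (by omega)
  by_cases c4057 : V ≤ 4224
  · exact checkV_sound _ _ ck4057 V (by omega) (by omega)
  by_cases c4225 : V ≤ 4410
  · exact checkV_sound _ _ ck4225 V (by omega) (by omega)
  by_cases c4411 : V ≤ 4624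
  · exact checkV_sound _ _ ck4411 V (by omega) (by omega)
  exact checkV_sound _ _ ck4625 V (by omega) (by omega)

/-- **T_A arithmetic exclusion, orders `1701 … 5000`.** No shape list with at least two members that is `SieveAdmissible M`, `U11G M` and
`TAKnap575.E3Adm M` beats `τ = 2371/1000` at an order `1701 ≤ M ≤ 5000`. [original] -/
theorem not_beats_2371 (N M : ℕ) (a b c : Fin N → ℕ) (hN : 2 ≤ N) (h1 : 1701 ≤ M) (h2 : M ≤ 5000)
    (hS : SieveAdmissible M a b c) (hG : U11G M a b c) (hE : TAKnap575.E3Adm M a b c) : ¬ Beats (2371 / 1000) M a b c :=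
  not_beats_of_cert mono_ok dom_all ck_all hN h1 h2 hS hG hE

end TAStat

/-- **T_A/5000.** No abelian STPP host of order `≤ 5000` beats the record exponent `2.371`: `Σ_i (|A_i||B_i||C_i|)^{2.371/3} ≤ |H|` for every
STPP family in every finite abelian group `H` with `|H| ≤ 5000`.  Orders `≤ 1700`: `noAbelianSTPPHostUpTo_2371_1700`; orders `1701 … 5000`:
`AbelianTECensus.sieveSound`, `u11GSound_holds`, `TAKnap575.e3Adm_of_isSTPP` and `TAStat.not_beats_2371`.
WHAT THIS IS NOT: no bound on `ω`; rung-leaf class; nothing about orders `≥ 5001`, the `5/2` lists, or non-abelian hosts. [original] -/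
theorem noAbelianSTPPHostUpTo_2371_5000 : NoAbelianSTPPHostUpTo (2371 / 1000) 5000 := by
  classical
  refine AbelianTECensus.noAbelianSTPPHostUpTo_of_two (τ := 2371 / 1000) (by norm_num) (by norm_num) ?_
  intro H _ _ hM N A B C hS hne hN
  by_cases h1700 : Fintype.card H ≤ 1700
  · exact noAbelianSTPPHostUpTo_2371_1700 H h1700 N A B C hS
  · have hadm := AbelianTECensus.sieveSound H N A B C hS hne
    have hG := u11GSound_holds H N A B C hS hne
    have he3 := TAKnap575.e3Adm_of_isSTPP hS hne
    have h := TAStat.not_beats_2371 N (Fintype.card H) _ _ _ hN (by omega) hM hadm hG he3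
    unfold Beats at h
    rw [not_lt] at h
    simpa [shapeVol] using h

end Summit.MatrixMultiplication.MatrixMultiplication.Theorems
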